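import Literature.Geometry.Manifold.SmoothSingularChains
import Literature.Geometry.Manifold.CubeToSimplex
import Literature.Geometry.Kaehler.FormPullbackWithin
import Mathlib.MeasureTheory.Integral.DivergenceTheorem
import Mathlib.Analysis.Calculus.FDeriv.CompCLM
import HarnessLib

/-!
# Integration of differential forms over smooth singular simplices; Stokes' formula

Fourth brick of the integration proof of **de Rham's theorem**: the de Rham homomorphism at
the cochain level, `ω ↦ (σ ↦ ∫_σ ω)` (de Rham 1931; Warner (1983), 4.17; Bredon (1993), §V.5;
Lee (2013), pp. 481–482), and **Stokes' theorem for chains** `∫_σ dβ = ∑ⱼ (-1)ʲ ∫_{dⱼσ} β`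
(Lee (2013), Thm. 18.12; Bredon (1993), Thm. V.5.4; Warner 4.19), which says that it is a cochain
map.

Design (see `…Manifold.CubeToSimplex`): a smooth singular `k`-simplex `σ` (`C^∞` within the closed
simplex, `…SingularSimplex.IsSmooth`) is integrated over through the **collapsed cube**:
`∫_σ ω := ∫_{t ∈ [0,1]ᵏ} (F_σ^* ω)(t)(e₁, …, e_k) dt`, `F_σ = σ̃ ∘ cubeToSimplex k` (`σ̃ = σ.bext`),
with the within-set pull-back `MForm.pullbackWithin` of `…Kaehler.FormPullbackWithin` (continuous
up to the boundary of the cube). Stokes' formula is then Mathlib's divergence theorem on the box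
`MeasureTheory.integral_divergence_of_hasFDerivAt_off_countable'`: the front faces `tᵢ = 1` of the
cube are the facets `d_{i}σ` (`i ≤ k-1`, as `castSucc i`), the back face `t_{k-1} = 0` is the last
facet, and on the other back faces the pulled-back `(k-1)`-form vanishes identically (the collapse
does not depend on the later coordinates there). We never need to compare with the "simplex"
parametrisation: for the de Rham theorem only linearity, naturality, the cochain property and the
value on `0`-simplices matter.

* `SingularSimplex.cubeMap`, `formIntegrand`, `formIntegral` (`∫_σ ω`); regularity
  (`contDiffOn_formPullback`, `continuousOn_formIntegrand`, `integrableOn_formIntegrand`);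
* linearity in `ω`; `formIntegral_eq_of_zero` (a `0`-simplex: evaluation at the point);
  naturality `formIntegral_map` (`∫_{φ ∘ σ} ω = ∫_σ φ^*ω`);
* `formIntegral_mextDeriv` — **Stokes' formula** for a smooth `(n+1)`-simplex and a form smooth
  near its image.

## References

* J. M. Lee, *Introduction to Smooth Manifolds*, 2nd ed. (2013), pp. 481–484, Thm. 18.12.
* G. E. Bredon, *Topology and Geometry* (1993), §V.5, Thm. V.5.4.
* F. W. Warner, *Foundations of Differentiable Manifolds and Lie Groups* (1983), 4.17–4.19.
-/

noncomputable section

-- `TangentSpace 𝓘(ℝ, ℝᵏ) t = ℝᵏ` and the instance paths on it are used up to unfolding (as in the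
-- tree's singular-homology files)
set_option backward.isDefEq.respectTransparency false

open scoped Manifold ContDiff Topology
open Set Filter MeasureTheory Literature.AlgebraicTopology.SingularHomology Literature.Geometry.Kaehler

universe u v

namespace Literature.Geometry.Manifold

variable {E : Type u} [NormedAddCommGroup E] [NormedSpace ℝ E]
  {H : Type*} [TopologicalSpace H] {I : ModelWithCorners ℝ E H}
  {M : Type u} [TopologicalSpace M] [ChartedSpace H M]
  {F : Type v} [NormedAddCommGroup F] [NormedSpace ℝ F]

/-! ### The cube and its standard frame -/

/-- The unit cube `[0,1]ᵏ ⊆ ℝᵏ`. [folklore] -/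
abbrev unitCube (k : ℕ) : Set (Fin k → ℝ) := Icc 0 1

/-- The standard frame `(e₁, …, e_k)` of `ℝᵏ`. [folklore] -/
abbrev stdFrame (k : ℕ) : Fin k → (Fin k → ℝ) := fun i ↦ Pi.single i 1

/-- The open cube is contained in the closed cube. [folklore] -/
theorem pi_Ioo_subset_unitCube (k : ℕ) :
    (Set.pi univ fun _ : Fin k ↦ Ioo (0 : ℝ) 1) ⊆ unitCube k := fun _ ht ↦
  ⟨fun i ↦ (ht i (mem_univ i)).1.le, fun i ↦ (ht i (mem_univ i)).2.le⟩

/-- The open cube is open. [folklore] -/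
theorem isOpen_pi_Ioo (k : ℕ) : IsOpen (Set.pi univ fun _ : Fin k ↦ Ioo (0 : ℝ) 1) :=
  isOpen_set_pi finite_univ fun _ _ ↦ isOpen_Ioo

/-- The closed cube is a neighbourhood of each point of the open cube. [folklore] -/
theorem unitCube_mem_nhds {k : ℕ} {t : Fin k → ℝ} (ht : t ∈ Set.pi univ fun _ : Fin k ↦ Ioo (0 : ℝ) 1) :
    unitCube k ∈ 𝓝 t :=
  mem_of_superset ((isOpen_pi_Ioo k).mem_nhds ht) (pi_Ioo_subset_unitCube k)

/-- **The cube is a set of unique differentiability** (convex with nonempty interior). [folklore] -/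
theorem uniqueDiffOn_unitCube (k : ℕ) : UniqueDiffOn ℝ (unitCube k) := by
  refine uniqueDiffOn_convex (convex_Icc 0 1) ⟨fun _ ↦ 1 / 2, ?_⟩
  refine interior_maximal (pi_Ioo_subset_unitCube k) (isOpen_pi_Ioo k) ?_
  exact fun i _ ↦ ⟨by norm_num, by norm_num⟩

/-- The cube is compact. [folklore] -/
theorem isCompact_unitCube (k : ℕ) : IsCompact (unitCube k) := isCompact_Icc

end Literature.Geometry.Manifold

namespace Literature.AlgebraicTopology.SingularHomology.SingularSimplex

open Literature.Geometry.Manifold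

variable {E : Type u} [NormedAddCommGroup E] [NormedSpace ℝ E]
  {H : Type*} [TopologicalSpace H] {I : ModelWithCorners ℝ E H}
  {M : Type u} [TopologicalSpace M] [ChartedSpace H M]
  {F : Type v} [NormedAddCommGroup F] [NormedSpace ℝ F] {k : ℕ}

/-! ### The cube parametrisation of a simplex and the integrand -/

/-- **The cube parametrisation `F_σ = σ̃ ∘ cubeToSimplex k : ℝᵏ → M` of a singular simplex**
(on the cube it is `σ` composed with the collapse of the cube onto `Δᵏ`). Dot-notation extension
of `SingularSimplex`, declared from `Literature/Geometry/Manifold`. [cite: LeeSmoothManifolds2013, p. 481] -/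
def cubeMap (σ : SingularSimplex M k) : (Fin k → ℝ) → M := σ.bext ∘ Literature.Geometry.Manifold.cubeToSimplex k

/-- Values of the cube parametrisation. [folklore] -/
theorem cubeMap_apply (σ : SingularSimplex M k) (t : Fin k → ℝ) :
    σ.cubeMap t = σ.bext (Literature.Geometry.Manifold.cubeToSimplex k t) :=
  rfl

/-- On the cube the parametrisation takes values in the image of the simplex. [folklore] -/
theorem cubeMap_mem_range (σ : SingularSimplex M k) {t : Fin k → ℝ} (ht : t ∈ unitCube k) :
    σ.cubeMap t ∈ σ.range :=
  σ.mapsTo_bext_range (cubeToSimplex_mem_stdSimplex ht)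

/-- The cube parametrisation commutes with push-forward. [folklore] -/
theorem cubeMap_map {N : Type u} [TopologicalSpace N] (f : C(M, N)) (σ : SingularSimplex M k) :
    (σ.map f).cubeMap = f ∘ σ.cubeMap := by
  rw [cubeMap, bext_map, cubeMap, Function.comp_assoc]

/-- **The cube parametrisation of a smooth simplex is `C^∞` within the cube** (chain rule within
sets: the collapse is polynomial and maps the cube into `Δᵏ`). [cite: LeeSmoothManifolds2013, p. 481] -/
theorem IsSmooth.contMDiffOn_cubeMap {σ : SingularSimplex M k} (hσ : σ.IsSmooth I) :
    ContMDiffOn 𝓘(ℝ, Fin k → ℝ) I ∞ σ.cubeMap (unitCube k) :=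
  hσ.comp (contDiff_cubeToSimplex k).contMDiff.contMDiffOn (mapsTo_cubeToSimplex k)

/-- **The integrand of `∫_σ ω`**: `t ↦ (F_σ^* ω)(t)(e₁, …, e_k)`, the within-cube pull-back of `ω`
along the cube parametrisation, evaluated on the standard frame (Lee (2013), p. 481, in the
collapsed-cube parametrisation). [cite: LeeSmoothManifolds2013, p. 481] -/
def formIntegrand (σ : SingularSimplex M k) (η : MForm I M F k) (t : Fin k → ℝ) : F :=
  MForm.pullbackWithin η σ.cubeMap (unitCube k) t (stdFrame k)

/-- **The integral `∫_σ ω` of a `k`-form over a singular `k`-simplex** (meaningful for smooth `σ`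
and `ω` smooth near its image): the Bochner integral over the cube of the integrand
(de Rham 1931; Warner (1983), 4.17; Lee (2013), p. 481). [cite: LeeSmoothManifolds2013, p. 481] -/
def formIntegral (σ : SingularSimplex M k) (η : MForm I M F k) : F :=
  ∫ t in unitCube k, σ.formIntegrand η t

/-- Unfolding the integrand. [folklore] -/
theorem formIntegrand_apply (σ : SingularSimplex M k) (η : MForm I M F k) (t : Fin k → ℝ) :
    σ.formIntegrand η t =
      η (σ.cubeMap t) (fun i ↦ mfderivWithin 𝓘(ℝ, Fin k → ℝ) I σ.cubeMap (unitCube k) t (Pi.single i 1)) :=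
  rfl

/-! ### Linearity in the form -/

/-- The integrand is additive in the form. [folklore] -/
theorem formIntegrand_add (σ : SingularSimplex M k) (η₁ η₂ : MForm I M F k) :
    σ.formIntegrand (η₁ + η₂) = σ.formIntegrand η₁ + σ.formIntegrand η₂ := by
  funext t
  rfl

/-- The integrand is homogeneous in the form. [folklore] -/
theorem formIntegrand_smul (σ : SingularSimplex M k) (c : ℝ) (η : MForm I M F k) :
    σ.formIntegrand (c • η) = c • σ.formIntegrand η := by
  funext t
  rfl

/-- The integrand of the zero form vanishes. [folklore] -/
@[simp]
theorem formIntegrand_zero (σ : SingularSimplex M k) : σ.formIntegrand (0 : MForm I M F k) = 0 := by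
  funext t
  rfl

/-- `∫_σ 0 = 0`. [folklore] -/
@[simp]
theorem formIntegral_zero (σ : SingularSimplex M k) : σ.formIntegral (0 : MForm I M F k) = 0 := by
  rw [formIntegral, formIntegrand_zero]
  exact integral_zero _ _

/-- `∫_σ (c • ω) = c • ∫_σ ω`. [folklore] -/
theorem formIntegral_smul (σ : SingularSimplex M k) (c : ℝ) (η : MForm I M F k) :
    σ.formIntegral (c • η) = c • σ.formIntegral η := by
  rw [formIntegral, formIntegrand_smul]
  exact integral_smul c _

/-! ### Regularity of the integrand -/

section Regularity

variable [IsManifold I ∞ M]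

/-- **The within-cube pull-back along a smooth simplex is `C^∞` on the cube**, for a form smooth at
the points of the image. [cite: LeeSmoothManifolds2013, p. 481] -/
theorem contDiffOn_formPullback {σ : SingularSimplex M k} (hσ : σ.IsSmooth I) {η : MForm I M F k}
    (hη : ∀ x ∈ σ.range, η.SmoothAt x) :
    ContDiffOn ℝ ∞ (MForm.pullbackWithin η σ.cubeMap (unitCube k)) (unitCube k) :=
  MForm.contDiffOn_pullbackWithin (uniqueDiffOn_unitCube k) hσ.contMDiffOn_cubeMap fun _ ht ↦
    hη _ (σ.cubeMap_mem_range ht)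

/-- The integrand of `∫_σ ω` is continuous on the cube. [cite: LeeSmoothManifolds2013, p. 481] -/
theorem continuousOn_formIntegrand {σ : SingularSimplex M k} (hσ : σ.IsSmooth I) {η : MForm I M F k}
    (hη : ∀ x ∈ σ.range, η.SmoothAt x) : ContinuousOn (σ.formIntegrand η) (unitCube k) :=
  (continuous_eval_const (stdFrame k)).comp_continuousOn (contDiffOn_formPullback hσ hη).continuousOn

/-- The integrand of `∫_σ ω` is integrable on the cube. [cite: LeeSmoothManifolds2013, p. 481] -/
theorem integrableOn_formIntegrand {σ : SingularSimplex M k} (hσ : σ.IsSmooth I) {η : MForm I M F k}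
    (hη : ∀ x ∈ σ.range, η.SmoothAt x) : IntegrableOn (σ.formIntegrand η) (unitCube k) :=
  (continuousOn_formIntegrand hσ hη).integrableOn_compact (isCompact_unitCube k)

/-- **`∫_σ` is additive** on forms smooth near the image of the smooth simplex `σ`. [cite: LeeSmoothManifolds2013, Prop. 18.11 proof] -/
theorem formIntegral_add {σ : SingularSimplex M k} (hσ : σ.IsSmooth I) {η₁ η₂ : MForm I M F k}
    (hη₁ : ∀ x ∈ σ.range, η₁.SmoothAt x) (hη₂ : ∀ x ∈ σ.range, η₂.SmoothAt x) :
    σ.formIntegral (η₁ + η₂) = σ.formIntegral η₁ + σ.formIntegral η₂ := by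
  rw [formIntegral, formIntegrand_add]
  exact integral_add (integrableOn_formIntegrand hσ hη₁) (integrableOn_formIntegrand hσ hη₂)

end Regularity

/-! ### Degree zero: evaluation at the point -/

/-- **A `0`-form integrates over a `0`-simplex to its value at the point.** [cite: LeeSmoothManifolds2013, p. 481] -/
theorem formIntegral_eq_of_zero [CompleteSpace F] (σ : SingularSimplex M 0) (η : MForm I M F 0) :
    σ.formIntegral η = η (toContinuousMap σ default) Fin.elim0 := by
  have hval : ∀ t, σ.formIntegrand η t = η (toContinuousMap σ default) Fin.elim0 := fun t ↦ by
    rw [formIntegrand_apply]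
    have hpt : σ.cubeMap t = toContinuousMap σ default := by
      rw [cubeMap_apply, bext_eq_const_of_zero]
    rw [hpt]
    congr 1
    exact funext fun i ↦ Fin.elim0 i
  simp only [formIntegral, hval]
  rw [setIntegral_const]
  have hvol : (volume : Measure (Fin 0 → ℝ)).real (unitCube 0) = 1 := by
    rw [Measure.real, show unitCube 0 = univ from eq_univ_of_forall fun t ↦ ⟨fun i ↦ Fin.elim0 i, fun i ↦ Fin.elim0 i⟩,
      MeasureTheory.volume_pi, Measure.pi_univ]
    simp
  rw [hvol, one_smul]

/-- A form takes equal values (on the same vectors of the model space) at equal points — the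
dependent-type bookkeeping for `η x v` versus `η y v` when `x = y`. [folklore] -/
theorem _root_.Literature.Geometry.Kaehler.MForm.congr_point (η : MForm I M F k) {x y : M} (h : x = y)
    {v : Fin k → E} : η x v = η y v := by
  subst h
  rfl

/-! ### Naturality under smooth maps -/

section Naturality

variable {E' : Type u} [NormedAddCommGroup E'] [NormedSpace ℝ E']
  {H' : Type*} [TopologicalSpace H'] {I' : ModelWithCorners ℝ E' H'}
  {N : Type u} [TopologicalSpace N] [ChartedSpace H' N]

/-- **Naturality of the integrand**: `(φ ∘ σ)^* ω = σ^*(φ^* ω)` on the cube (chain rule within the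
cube; Lee (2013), Prop. 18.9(c) / Lemma 14.16). [cite: LeeSmoothManifolds2013, Prop. 18.9] -/
theorem formIntegrand_map {σ : SingularSimplex M k} (hσ : σ.IsSmooth I) {φ : M → N}
    (hφ : ContMDiff I I' ∞ φ) (η : MForm I' N F k) {t : Fin k → ℝ} (ht : t ∈ unitCube k) :
    (σ.map ⟨φ, hφ.continuous⟩).formIntegrand η t = σ.formIntegrand (η.pullback I φ) t := by
  rw [formIntegrand_apply, formIntegrand_apply]
  have hF : MDifferentiableWithinAt 𝓘(ℝ, Fin k → ℝ) I σ.cubeMap (unitCube k) t :=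
    (hσ.contMDiffOn_cubeMap t ht).mdifferentiableWithinAt (by simp)
  have hcomp : mfderivWithin 𝓘(ℝ, Fin k → ℝ) I' ((σ.map ⟨φ, hφ.continuous⟩).cubeMap) (unitCube k) t =
      (mfderiv I I' φ (σ.cubeMap t)).comp (mfderivWithin 𝓘(ℝ, Fin k → ℝ) I σ.cubeMap (unitCube k) t) := by
    rw [cubeMap_map]
    exact mfderiv_comp_mfderivWithin t ((hφ _).mdifferentiableAt (by simp)) hF
      ((uniqueDiffOn_unitCube k) t ht).uniqueMDiffWithinAt
  have hpt : (σ.map ⟨φ, hφ.continuous⟩).cubeMap t = φ (σ.cubeMap t) := by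
    rw [cubeMap_map]; rfl
  rw [hcomp, MForm.congr_point η hpt]
  rfl

/-- **Naturality of `∫_σ`**: `∫_{φ ∘ σ} ω = ∫_σ φ^* ω` for a smooth simplex `σ` and a `C^∞` map `φ`
(Lee (2013), Prop. 18.9(c)). [cite: LeeSmoothManifolds2013, Prop. 18.9] -/
theorem formIntegral_map {σ : SingularSimplex M k} (hσ : σ.IsSmooth I) {φ : M → N}
    (hφ : ContMDiff I I' ∞ φ) (η : MForm I' N F k) :
    (σ.map ⟨φ, hφ.continuous⟩).formIntegral η = σ.formIntegral (η.pullback I φ) :=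
  setIntegral_congr_fun measurableSet_Icc fun _ ht ↦ formIntegrand_map hσ hφ η ht

end Naturality

end Literature.AlgebraicTopology.SingularHomology.SingularSimplex

/-! ### Stokes' formula for a smooth simplex -/

namespace Literature.AlgebraicTopology.SingularHomology.SingularSimplex

open Literature.Geometry.Manifold

variable {E : Type u} [NormedAddCommGroup E] [NormedSpace ℝ E]
  {H : Type*} [TopologicalSpace H] {I : ModelWithCorners ℝ E H}
  {M : Type u} [TopologicalSpace M] [ChartedSpace H M]
  {F : Type v} [NormedAddCommGroup F] [NormedSpace ℝ F] {n : ℕ}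

/-! #### The affine face maps of the cube and their derivative -/

/-- Inserting a zero commutes with addition of tuples. [folklore] -/
theorem insertNth_zero_add (i : Fin (n + 1)) (p q : Fin n → ℝ) :
    (Fin.insertNth i (0 : ℝ) (p + q) : Fin (n + 1) → ℝ) = Fin.insertNth i (0 : ℝ) p + Fin.insertNth i (0 : ℝ) q := by
  have h := Fin.insertNth_binop (α := fun _ ↦ ℝ) (fun _ ↦ (· + ·)) i (0 : ℝ) 0 p q
  rw [add_zero] at h
  exact h

/-- **The linear part of the face maps**: `v ↦ insertNth i 0 v`, as a continuous linear map
`ℝⁿ → ℝⁿ⁺¹`. [folklore] -/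
def insertCLM (i : Fin (n + 1)) : (Fin n → ℝ) →L[ℝ] (Fin (n + 1) → ℝ) :=
  LinearMap.toContinuousLinearMap
    { toFun := fun v ↦ Fin.insertNth i (0 : ℝ) v
      map_add' := insertNth_zero_add i
      map_smul' := fun c v ↦ insertNth_zero_smul i c v }

/-- Values of `insertCLM`. [folklore] -/
@[simp]
theorem insertCLM_apply (i : Fin (n + 1)) (v : Fin n → ℝ) : insertCLM i v = Fin.insertNth i (0 : ℝ) v := rfl

/-- `insertCLM i` sends the `l`-th basis vector to the `succAbove i l`-th one. [folklore] -/
theorem insertCLM_single (i : Fin (n + 1)) (l : Fin n) :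
    insertCLM i (Pi.single l 1) = Pi.single (i.succAbove l) 1 := by
  rw [insertCLM_apply]
  ext j
  cases j using Fin.succAboveCases i with
  | x =>
    rw [Fin.insertNth_apply_same, Pi.single_apply, if_neg (Fin.succAbove_ne i l).symm]
  | p m =>
    rw [Fin.insertNth_apply_succAbove]
    simp only [Pi.single_apply, Fin.succAbove_right_inj]

/-- The face map `x ↦ insertNth i c x` is affine with derivative `insertCLM i`. [folklore] -/
theorem hasFDerivAt_insertNth (i : Fin (n + 1)) (c : ℝ) (x : Fin n → ℝ) :
    HasFDerivAt (fun y : Fin n → ℝ ↦ (Fin.insertNth i c y : Fin (n + 1) → ℝ)) (insertCLM i) x := by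
  have h : (fun y : Fin n → ℝ ↦ (Fin.insertNth i c y : Fin (n + 1) → ℝ)) =
      fun y ↦ (Fin.insertNth i c (0 : Fin n → ℝ) : Fin (n + 1) → ℝ) + insertCLM i y := by
    funext y
    ext j
    rw [Pi.add_apply, insertCLM_apply]
    cases j using Fin.succAboveCases i with
    | x => rw [Fin.insertNth_apply_same, Fin.insertNth_apply_same, Fin.insertNth_apply_same, add_zero]
    | p m =>
      rw [Fin.insertNth_apply_succAbove, Fin.insertNth_apply_succAbove, Fin.insertNth_apply_succAbove,
        Pi.zero_apply, zero_add]
  rw [h]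
  exact (insertCLM i).hasFDerivAt.const_add _

/-- The face maps send the `n`-cube into the `(n+1)`-cube for `c ∈ [0, 1]`. [folklore] -/
theorem insertNth_mem_unitCube (i : Fin (n + 1)) {c : ℝ} (hc : c ∈ Icc (0 : ℝ) 1) {x : Fin n → ℝ}
    (hx : x ∈ unitCube n) : (Fin.insertNth i c x : Fin (n + 1) → ℝ) ∈ unitCube (n + 1) := by
  refine ⟨Fin.le_insertNth_iff.2 ⟨hc.1, fun j ↦ hx.1 j⟩, Fin.insertNth_le_iff.2 ⟨hc.2, fun j ↦ hx.2 j⟩⟩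

section Chain

/-- **Chain rule along a face map**: the within-cube derivative of `G = Fm ∘ insertNth i c` on the
`n`-cube is the within-cube derivative of `Fm` composed with `insertCLM i`. [folklore] -/
theorem mfderivWithin_comp_insertNth {Fm : (Fin (n + 1) → ℝ) → M} {G : (Fin n → ℝ) → M}
    (i : Fin (n + 1)) {c : ℝ} (hc : c ∈ Icc (0 : ℝ) 1)
    (hG : EqOn G (fun x ↦ Fm (Fin.insertNth i c x)) (unitCube n)) {x : Fin n → ℝ} (hx : x ∈ unitCube n)
    (hF : MDifferentiableWithinAt 𝓘(ℝ, Fin (n + 1) → ℝ) I Fm (unitCube (n + 1)) (Fin.insertNth i c x)) :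
    mfderivWithin 𝓘(ℝ, Fin n → ℝ) I G (unitCube n) x =
      (mfderivWithin 𝓘(ℝ, Fin (n + 1) → ℝ) I Fm (unitCube (n + 1)) (Fin.insertNth i c x)).comp (insertCLM i) := by
  have hU : UniqueMDiffWithinAt 𝓘(ℝ, Fin n → ℝ) (unitCube n) x :=
    ((uniqueDiffOn_unitCube n) x hx).uniqueMDiffWithinAt
  have hA : HasFDerivAt (fun y : Fin n → ℝ ↦ (Fin.insertNth i c y : Fin (n + 1) → ℝ)) (insertCLM i) x :=
    hasFDerivAt_insertNth i c x
  have hAd : MDifferentiableWithinAt 𝓘(ℝ, Fin n → ℝ) 𝓘(ℝ, Fin (n + 1) → ℝ)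
      (fun y : Fin n → ℝ ↦ (Fin.insertNth i c y : Fin (n + 1) → ℝ)) (unitCube n) x :=
    hA.differentiableAt.differentiableWithinAt.mdifferentiableWithinAt
  have h1 : mfderivWithin 𝓘(ℝ, Fin n → ℝ) I G (unitCube n) x =
      mfderivWithin 𝓘(ℝ, Fin n → ℝ) I (Fm ∘ fun y ↦ Fin.insertNth i c y) (unitCube n) x :=
    (hG.eventuallyEq_nhdsWithin).mfderivWithin_eq (hG hx)
  rw [h1, mfderivWithin_comp x hF hAd (fun y hy ↦ insertNth_mem_unitCube i hc hy) hU]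
  congr 1
  rw [mfderivWithin_eq_fderivWithin, hA.hasFDerivWithinAt.fderivWithin (uniqueDiffOn_unitCube n x hx)]

end Chain

/-! #### Faces of the simplex in the cube parametrisation -/

/-- The affine combination of the coface vertices is `insertNth j 0`. [folklore] -/
theorem sum_smul_single_succAbove (j : Fin (n + 2)) (y : Fin (n + 1) → ℝ) :
    ∑ m, y m • (Pi.single (j.succAbove m) (1 : ℝ) : Fin (n + 2) → ℝ) = Fin.insertNth j (0 : ℝ) y := by
  ext q
  rw [Finset.sum_apply]
  simp only [Pi.smul_apply, Pi.single_apply, smul_eq_mul, mul_ite, mul_one, mul_zero]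
  cases q using Fin.succAboveCases j with
  | x =>
    rw [Fin.insertNth_apply_same]
    exact Finset.sum_eq_zero fun m _ ↦ if_neg (Fin.succAbove_ne j m).symm
  | p m₀ =>
    rw [Fin.insertNth_apply_succAbove, Finset.sum_eq_single m₀]
    · rw [if_pos rfl]
    · intro m _ hm
      rw [if_neg fun h ↦ hm (Fin.succAbove_right_injective h).symm]
    · exact fun h ↦ (h (Finset.mem_univ _)).elim

/-- **The barycentric extension of a face** is the extension of the simplex at the inserted
coordinates: `(dⱼσ)~(y) = σ~(insertNth j 0 y)` for `y ∈ Δⁿ`. [folklore] -/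
theorem bext_face_apply (σ : SingularSimplex M (n + 1)) (j : Fin (n + 2)) {y : Fin (n + 1) → ℝ}
    (hy : y ∈ stdSimplex ℝ (Fin (n + 1))) :
    (σ.face j).bext y = σ.bext (Fin.insertNth j (0 : ℝ) y) := by
  rw [face_eq_compose, bext_compose_apply_of_mem σ _ hy]
  congr 1
  exact sum_smul_single_succAbove j y

/-- **Front faces**: on the `n`-cube, the cube parametrisation of the facet `d_{i}σ`
(`i = castSucc i'`) is that of `σ` on the face `t_{i'} = 1`. [cite: LeeSmoothManifolds2013, Thm. 18.12 proof] -/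
theorem cubeMap_face_castSucc (σ : SingularSimplex M (n + 1)) (i : Fin (n + 1)) {x : Fin n → ℝ}
    (hx : x ∈ unitCube n) :
    (σ.face (Fin.castSucc i)).cubeMap x = σ.cubeMap (Fin.insertNth i (1 : ℝ) x) := by
  rw [cubeMap_apply, cubeMap_apply, cubeToSimplex_insertNth_one,
    bext_face_apply σ _ (cubeToSimplex_mem_stdSimplex hx)]

/-- **The last back face**: on the `n`-cube, the cube parametrisation of the last facet `d_{n+1}σ`
is that of `σ` on the face `t_n = 0` (last coordinate). [cite: LeeSmoothManifolds2013, Thm. 18.12 proof] -/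
theorem cubeMap_face_last (σ : SingularSimplex M (n + 1)) {x : Fin n → ℝ} (hx : x ∈ unitCube n) :
    (σ.face (Fin.last (n + 1))).cubeMap x = σ.cubeMap (Fin.insertNth (Fin.last n) (0 : ℝ) x) := by
  rw [cubeMap_apply, cubeMap_apply, cubeToSimplex_insertNth_last_zero,
    bext_face_apply σ _ (cubeToSimplex_mem_stdSimplex hx)]

section Degenerate

/-- **Degenerate back faces**: on a back face `tᵢ = 0` with `i < n`, the within-cube derivative of
the cube parametrisation of a smooth simplex kills the last basis vector (the collapse does not
depend on the later coordinates there). [folklore] -/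
theorem mfderivWithin_cubeMap_back_apply_last {σ : SingularSimplex M (n + 1)} (hσ : σ.IsSmooth I)
    {i : Fin (n + 1)} (hi : i < Fin.last n) {x : Fin n → ℝ} (hx : x ∈ unitCube n) :
    mfderivWithin 𝓘(ℝ, Fin (n + 1) → ℝ) I σ.cubeMap (unitCube (n + 1)) (Fin.insertNth i (0 : ℝ) x)
      (Pi.single (Fin.last n) 1) = 0 := by
  set t : Fin (n + 1) → ℝ := Fin.insertNth i (0 : ℝ) x with ht
  have htQ : t ∈ unitCube (n + 1) := insertNth_mem_unitCube i ⟨le_rfl, zero_le_one⟩ hx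
  have hU : UniqueMDiffWithinAt 𝓘(ℝ, Fin (n + 1) → ℝ) (unitCube (n + 1)) t :=
    ((uniqueDiffOn_unitCube _) t htQ).uniqueMDiffWithinAt
  have hc : MDifferentiableWithinAt 𝓘(ℝ, Fin (n + 1) → ℝ) 𝓘(ℝ, Fin (n + 2) → ℝ)
      (Literature.Geometry.Manifold.cubeToSimplex (n + 1)) (unitCube (n + 1)) t :=
    ((differentiable_cubeToSimplex (n + 1)) t).differentiableWithinAt.mdifferentiableWithinAt
  have hb : MDifferentiableWithinAt 𝓘(ℝ, Fin (n + 2) → ℝ) I σ.bext (stdSimplex ℝ (Fin (n + 2)))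
      (Literature.Geometry.Manifold.cubeToSimplex (n + 1) t) :=
    (hσ _ (cubeToSimplex_mem_stdSimplex htQ)).mdifferentiableWithinAt (by simp)
  have hz : mfderivWithin 𝓘(ℝ, Fin (n + 1) → ℝ) 𝓘(ℝ, Fin (n + 2) → ℝ)
      (Literature.Geometry.Manifold.cubeToSimplex (n + 1)) (unitCube (n + 1)) t (Pi.single (Fin.last n) 1) = 0 := by
    rw [mfderivWithin_eq_fderivWithin,
      fderivWithin_eq_fderiv ((uniqueDiffOn_unitCube _) t htQ) ((differentiable_cubeToSimplex (n + 1)) t)]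
    exact fderiv_cubeToSimplex_single_eq_zero hi (by simp [ht])
  rw [cubeMap, mfderivWithin_comp t hb hc (mapsTo_cubeToSimplex (n + 1)) hU]
  change (mfderivWithin 𝓘(ℝ, Fin (n + 2) → ℝ) I σ.bext (stdSimplex ℝ (Fin (n + 2)))
      (Literature.Geometry.Manifold.cubeToSimplex (n + 1) t))
    (mfderivWithin 𝓘(ℝ, Fin (n + 1) → ℝ) 𝓘(ℝ, Fin (n + 2) → ℝ)
      (Literature.Geometry.Manifold.cubeToSimplex (n + 1)) (unitCube (n + 1)) t (Pi.single (Fin.last n) 1)) = 0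
  rw [hz, map_zero]

end Degenerate

/-! #### Stokes' formula -/

section Stokes

variable [IsManifold I ∞ M]

/-- **Stokes' formula for a smooth singular simplex.** For a smooth singular `(n+1)`-simplex `σ`
and an `n`-form `β` smooth at the points of the image of `σ`,
`∫_σ dβ = ∑ⱼ (-1)ʲ ∫_{dⱼ σ} β`
(Lee (2013), Thm. 18.12, Stokes' theorem for chains; Bredon (1993), Thm. V.5.4; Warner (1983),
4.19). Proof: the divergence theorem on the cube `[0,1]ⁿ⁺¹`
(`MeasureTheory.integral_divergence_of_hasFDerivAt_off_countable'`) for the vector field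
`fᵢ = (-1)ⁱ (F_σ^*β)(ê_i)`, whose divergence is `(F_σ^* dβ)(e)` on the open cube; the front faces
`tᵢ = 1` are the facets `d_{castSucc i} σ`, the back face `t_n = 0` is the last facet, and the other
back faces are degenerate. [cite: LeeSmoothManifolds2013, Thm. 18.12] -/
theorem formIntegral_mextDeriv {σ : SingularSimplex M (n + 1)} (hσ : σ.IsSmooth I) {β : MForm I M F n}
    (hβ : ∀ x ∈ σ.range, β.SmoothAt x) :
    σ.formIntegral (mextDeriv β) = ∑ j : Fin (n + 2), ((-1 : ℝ) ^ (j : ℕ)) • (σ.face j).formIntegral β := by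
  -- data
  set Fm : (Fin (n + 1) → ℝ) → M := σ.cubeMap with hFm
  have hF : ContMDiffOn 𝓘(ℝ, Fin (n + 1) → ℝ) I ∞ Fm (unitCube (n + 1)) := hσ.contMDiffOn_cubeMap
  have hβF : ∀ t ∈ unitCube (n + 1), β.SmoothAt (Fm t) := fun t ht ↦
    hβ _ (σ.cubeMap_mem_range ht)
  set g : (Fin (n + 1) → ℝ) → (Fin (n + 1) → ℝ) [⋀^Fin n]→L[ℝ] F :=
    β.pullbackWithin Fm (unitCube (n + 1)) with hg
  have hgs : ContDiffOn ℝ ∞ g (unitCube (n + 1)) :=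
    MForm.contDiffOn_pullbackWithin (uniqueDiffOn_unitCube _) hF hβF
  -- the vector field and its derivative
  set e : Fin (n + 1) → (Fin (n + 1) → ℝ) := stdFrame (n + 1) with he
  set f : Fin (n + 1) → (Fin (n + 1) → ℝ) → F :=
    fun i t ↦ ((-1 : ℝ) ^ (i : ℕ)) • g t (Fin.removeNth i e) with hf
  set f' : Fin (n + 1) → (Fin (n + 1) → ℝ) → (Fin (n + 1) → ℝ) →L[ℝ] F :=
    fun i t ↦ fderivWithin ℝ (f i) (unitCube (n + 1)) t with hf'
  have hgu : ∀ u : Fin n → (Fin (n + 1) → ℝ), ContDiffOn ℝ ∞ (fun t ↦ g t u) (unitCube (n + 1)) :=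
    fun u ↦ (ContinuousAlternatingMap.apply ℝ (Fin (n + 1) → ℝ) F u).contDiff.comp_contDiffOn hgs
  have hfc : ∀ i, ContDiffOn ℝ ∞ (f i) (unitCube (n + 1)) := fun i ↦ (hgu _).const_smul _
  -- hypotheses of the divergence theorem
  have Hc : ∀ i, ContinuousOn (f i) (Icc 0 1) := fun i ↦ (hfc i).continuousOn
  have Hd : ∀ x ∈ (Set.pi univ fun i : Fin (n + 1) ↦ Ioo ((0 : Fin (n + 1) → ℝ) i) ((1 : Fin (n + 1) → ℝ) i)) \ ∅,
      ∀ i, HasFDerivAt (f i) (f' i x) x := by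
    intro x hx i
    have hxQ : unitCube (n + 1) ∈ 𝓝 x := unitCube_mem_nhds hx.1
    have hd : DifferentiableAt ℝ (f i) x := ((hfc i).contDiffAt hxQ).differentiableAt (by simp)
    have h' : f' i x = fderiv ℝ (f i) x := fderivWithin_of_mem_nhds hxQ
    rw [h']
    exact hd.hasFDerivAt
  have Hi : IntegrableOn (fun x ↦ ∑ i, f' i x (e i)) (Icc 0 1) := by
    refine ContinuousOn.integrableOn_compact isCompact_Icc (continuousOn_finsetSum _ fun i _ ↦ ?_)
    have h1 : ContinuousOn (f' i) (unitCube (n + 1)) :=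
      (hfc i).continuousOn_fderivWithin (uniqueDiffOn_unitCube _) (by simp)
    exact ((ContinuousLinearMap.apply ℝ F (e i)).continuous).comp_continuousOn h1
  have hDT := integral_divergence_of_hasFDerivAt_off_countable' (0 : Fin (n + 1) → ℝ) 1 zero_le_one f f' ∅
    countable_empty Hc Hd Hi
  -- LHS: the divergence is the integrand of `∫_σ dβ` on the open cube
  have hL : (∫ x in Icc (0 : Fin (n + 1) → ℝ) 1, ∑ i, f' i x (e i)) = σ.formIntegral (mextDeriv β) := by
    rw [formIntegral]
    change (∫ x in unitCube (n + 1), ∑ i, f' i x (e i)) = ∫ x in unitCube (n + 1), σ.formIntegrand (mextDeriv β) x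
    rw [MeasureTheory.volume_pi, ← setIntegral_congr_set Measure.univ_pi_Ioo_ae_eq_Icc,
      ← setIntegral_congr_set Measure.univ_pi_Ioo_ae_eq_Icc]
    refine setIntegral_congr_fun (isOpen_pi_Ioo (n + 1)).measurableSet fun x hx ↦ ?_
    have hxQ : unitCube (n + 1) ∈ 𝓝 x := unitCube_mem_nhds hx
    have hxQ' : x ∈ unitCube (n + 1) := pi_Ioo_subset_unitCube _ hx
    have hux : UniqueDiffWithinAt ℝ (unitCube (n + 1)) x := uniqueDiffOn_unitCube _ x hxQ'
    have hgd : DifferentiableWithinAt ℝ g (unitCube (n + 1)) x :=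
      (hgs x hxQ').differentiableWithinAt (by simp)
    have hsum : ∑ i, f' i x (e i) = extDerivWithin g (unitCube (n + 1)) x e := by
      rw [extDerivWithin_apply hgd hux]
      refine Finset.sum_congr rfl fun i _ ↦ ?_
      rw [hf']
      change fderivWithin ℝ (fun t ↦ ((-1 : ℝ) ^ (i : ℕ)) • g t (Fin.removeNth i e)) (unitCube (n + 1)) x (e i) = _
      rw [fderivWithin_fun_const_smul hux ((hgu _ x hxQ').differentiableWithinAt (by simp)),
        ← Int.cast_smul_eq_zsmul ℝ, Int.cast_pow, Int.cast_neg, Int.cast_one]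
      rfl
    rw [hsum, hg, MForm.extDerivWithin_pullbackWithin_of_mem_nhds hxQ hF (hβF x hxQ')]
    rfl
  -- RHS, front faces: `∫ fᵢ(tᵢ = 1) = (-1)ⁱ ∫_{d_{castSucc i} σ} β`
  have hfront : ∀ i : Fin (n + 1),
      (∫ x in Icc ((0 : Fin (n + 1) → ℝ) ∘ Fin.succAbove i) ((1 : Fin (n + 1) → ℝ) ∘ Fin.succAbove i),
          f i (Fin.insertNth i ((1 : Fin (n + 1) → ℝ) i) x)) =
        ((-1 : ℝ) ^ (i : ℕ)) • (σ.face (Fin.castSucc i)).formIntegral β := by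
    intro i
    change (∫ x in unitCube n, f i (Fin.insertNth i (1 : ℝ) x)) = _
    rw [formIntegral, ← integral_smul]
    refine setIntegral_congr_fun measurableSet_Icc fun x hx ↦ ?_
    change ((-1 : ℝ) ^ (i : ℕ)) • g (Fin.insertNth i (1 : ℝ) x) (Fin.removeNth i e) =
      ((-1 : ℝ) ^ (i : ℕ)) • (σ.face (Fin.castSucc i)).formIntegrand β x
    congr 1
    rw [formIntegrand_apply, hg, MForm.pullbackWithin_apply]
    have hpt := σ.cubeMap_face_castSucc i hx
    have hFd : MDifferentiableWithinAt 𝓘(ℝ, Fin (n + 1) → ℝ) I Fm (unitCube (n + 1)) (Fin.insertNth i (1 : ℝ) x) :=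
      (hF _ (insertNth_mem_unitCube i ⟨zero_le_one, le_rfl⟩ hx)).mdifferentiableWithinAt (by simp)
    have hD := mfderivWithin_comp_insertNth i ⟨zero_le_one, le_rfl⟩
      (fun y hy ↦ σ.cubeMap_face_castSucc i hy) hx hFd
    rw [MForm.congr_point β hpt, hD]
    congr 1
    funext l
    change (mfderivWithin 𝓘(ℝ, Fin (n + 1) → ℝ) I Fm (unitCube (n + 1)) (Fin.insertNth i (1 : ℝ) x))
        (e (i.succAbove l)) =
      (mfderivWithin 𝓘(ℝ, Fin (n + 1) → ℝ) I Fm (unitCube (n + 1)) (Fin.insertNth i (1 : ℝ) x))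
        (insertCLM i (Pi.single l 1))
    rw [insertCLM_single]
  -- RHS, the last back face: `∫ f_n(t_n = 0) = (-1)ⁿ ∫_{d_{n+1} σ} β`
  have hback_last :
      (∫ x in Icc ((0 : Fin (n + 1) → ℝ) ∘ Fin.succAbove (Fin.last n)) ((1 : Fin (n + 1) → ℝ) ∘ Fin.succAbove (Fin.last n)),
          f (Fin.last n) (Fin.insertNth (Fin.last n) ((0 : Fin (n + 1) → ℝ) (Fin.last n)) x)) =
        ((-1 : ℝ) ^ n) • (σ.face (Fin.last (n + 1))).formIntegral β := by
    change (∫ x in unitCube n, f (Fin.last n) (Fin.insertNth (Fin.last n) (0 : ℝ) x)) = _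
    rw [formIntegral, ← integral_smul]
    refine setIntegral_congr_fun measurableSet_Icc fun x hx ↦ ?_
    change ((-1 : ℝ) ^ ((Fin.last n : Fin (n + 1)) : ℕ)) • g (Fin.insertNth (Fin.last n) (0 : ℝ) x)
        (Fin.removeNth (Fin.last n) e) = ((-1 : ℝ) ^ n) • (σ.face (Fin.last (n + 1))).formIntegrand β x
    rw [Fin.val_last]
    congr 1
    rw [formIntegrand_apply, hg, MForm.pullbackWithin_apply]
    have hpt := σ.cubeMap_face_last hx
    have hFd : MDifferentiableWithinAt 𝓘(ℝ, Fin (n + 1) → ℝ) I Fm (unitCube (n + 1))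
        (Fin.insertNth (Fin.last n) (0 : ℝ) x) :=
      (hF _ (insertNth_mem_unitCube (Fin.last n) ⟨le_rfl, zero_le_one⟩ hx)).mdifferentiableWithinAt (by simp)
    have hD := mfderivWithin_comp_insertNth (Fin.last n) ⟨le_rfl, zero_le_one⟩
      (fun y hy ↦ σ.cubeMap_face_last hy) hx hFd
    rw [MForm.congr_point β hpt, hD]
    congr 1
    funext l
    change (mfderivWithin 𝓘(ℝ, Fin (n + 1) → ℝ) I Fm (unitCube (n + 1)) (Fin.insertNth (Fin.last n) (0 : ℝ) x))
        (e ((Fin.last n).succAbove l)) =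
      (mfderivWithin 𝓘(ℝ, Fin (n + 1) → ℝ) I Fm (unitCube (n + 1)) (Fin.insertNth (Fin.last n) (0 : ℝ) x))
        (insertCLM (Fin.last n) (Pi.single l 1))
    rw [insertCLM_single]
  -- RHS, the other back faces vanish
  have hback_zero : ∀ i : Fin (n + 1), i < Fin.last n →
      (∫ x in Icc ((0 : Fin (n + 1) → ℝ) ∘ Fin.succAbove i) ((1 : Fin (n + 1) → ℝ) ∘ Fin.succAbove i),
          f i (Fin.insertNth i ((0 : Fin (n + 1) → ℝ) i) x)) = 0 := by
    intro i hi
    change (∫ x in unitCube n, f i (Fin.insertNth i (0 : ℝ) x)) = 0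
    refine setIntegral_eq_zero_of_forall_eq_zero fun x hx ↦ ?_
    change ((-1 : ℝ) ^ (i : ℕ)) • g (Fin.insertNth i (0 : ℝ) x) (Fin.removeNth i e) = 0
    rw [hg, MForm.pullbackWithin_apply]
    obtain ⟨l₀, hl₀⟩ := Fin.exists_succAbove_eq (ne_of_lt hi).symm
    rw [ContinuousAlternatingMap.map_coord_zero _ l₀, smul_zero]
    change mfderivWithin 𝓘(ℝ, Fin (n + 1) → ℝ) I Fm (unitCube (n + 1)) (Fin.insertNth i (0 : ℝ) x)
      (e (i.succAbove l₀)) = 0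
    rw [hl₀]
    exact mfderivWithin_cubeMap_back_apply_last hσ hi hx
  -- assemble
  rw [← hL, hDT, Finset.sum_sub_distrib, Fin.sum_univ_castSucc (fun j : Fin (n + 2) ↦
      ((-1 : ℝ) ^ (j : ℕ)) • (σ.face j).formIntegral β),
    Fin.sum_univ_castSucc (fun i : Fin (n + 1) ↦ ∫ x in Icc ((0 : Fin (n + 1) → ℝ) ∘ Fin.succAbove i)
      ((1 : Fin (n + 1) → ℝ) ∘ Fin.succAbove i), f i (Fin.insertNth i ((0 : Fin (n + 1) → ℝ) i) x))]
  simp only [hfront, Fin.val_castSucc, hback_last, Fin.val_last]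
  rw [Finset.sum_eq_zero (fun l _ ↦ hback_zero (Fin.castSucc l) (Fin.castSucc_lt_last l)), zero_add,
    pow_succ, mul_neg_one, neg_smul, sub_eq_add_neg]

end Stokes

end Literature.AlgebraicTopology.SingularHomology.SingularSimplex
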